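import Mathlib
import Summits.Ventures.PercRepro2.Defs
import Summits.Ventures.PercRepro2.Graph
import Summits.Ventures.PercRepro2.Harris
import Summits.Ventures.PercRepro2.Events
import Summits.Ventures.PercRepro2.Independence
import Summits.Ventures.PercRepro2.Induced
import Summits.Ventures.PercRepro2.Exploration
import Summits.Ventures.PercRepro2.ContractDefs
import Summits.Ventures.PercRepro2.GateDefs
import Summits.Ventures.PercRepro2.GateAnatomy
import Summits.Ventures.PercRepro2.GateForest
import Summits.Ventures.PercRepro2.GateLSM
import Summits.Ventures.PercRepro2.GateSplit
import Summits.Ventures.PercRepro2.GateSplitForest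
import Summits.Ventures.PercRepro2.HullTree
import Summits.Ventures.PercRepro2.GateFeedbackForest
import Summits.Ventures.PercRepro2.GateFeedback
import Summits.Ventures.PercRepro2.GateFeedbackExit
import Summits.Ventures.PercRepro2.GateFeedbackGeneral
import Summits.Ventures.PercRepro2.GateContract
import Summits.Ventures.PercRepro2.GateShadow
import Summits.Ventures.PercRepro2.GateSide
import Summits.Ventures.PercRepro2.GateSep
import Summits.Ventures.PercRepro2.GateNear
import Summits.Ventures.PercRepro2.GateRestrict
import Summits.Ventures.PercRepro2.GateSepGeneral
import Summits.Ventures.PercRepro2.SideCluster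
import Summits.Ventures.PercRepro2.CactusDefs
import Summits.Ventures.PercRepro2.CactusTriangle
import Summits.Ventures.PercRepro2.CactusTriangleMass
import Summits.Ventures.PercRepro2.CactusCluster
import Summits.Ventures.PercRepro2.CactusDel
import Summits.Ventures.PercRepro2.CactusChain
import Summits.Ventures.PercRepro2.CactusKappa
import Summits.Ventures.PercRepro2.CactusGate
import Summits.Ventures.PercRepro2.CactusGeneral

/-!
# THEOREM 2 for an avoided SET: `(GATE A,{w})` at `T` whenever `G − T` is a triangular cactus
(blind cell PercRepro2, mine-c g11; proofs/MINEC-FEEDBACK.md §14, REMARK on avoided sets)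

g10's contraction (`GateContract.gateRow_contract_rep_iff`): the gate of `G` at the avoided set `T`
is the gate of `G/T` (every vertex of `T` sent to `t₀ ∈ T`) at `{t₀}`, and the edges of `G/T` not at
`t₀` are the edges of `G` avoiding `T` (`GateContract.Ft_contract_eq`), unchanged by the contraction
(`map_contractMap_of_avoid`). Since `IsCactusFrom` only reads the ends of the edges in the set
(`IsCactusFrom.congr`), «`G − T` is a triangular cactus» transfers to `G/T − t₀`, and Theorem 2 on
`G/T` gives the gate at `T` for every entry set (`gateRow_of_isCactus_del_set`); the exit version
takes the cactus hypothesis on `G/T − w` (`gateRow_of_isCactus_del_exit_set`).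
-/

namespace Summit.Ventures.PercRepro2

namespace CactusGate

open Cactus CactusChain GateSide

open scoped Classical

variable {V : Type*} {E : Type*}

/-- `IsCactusFrom` only reads the ends of the edges of the set: two edge families agreeing on `F`
have the same cacti `F`. -/
theorem _root_.Summit.Ventures.PercRepro2.Cactus.IsCactusFrom.congr {ends ends' : E → Sym2 V}
    {s : V} {F : Set E} (h : IsCactusFrom ends s F) (hagree : ∀ e ∈ F, ends' e = ends e) :
    IsCactusFrom ends' s F := by
  induction h with
  | empty => exact IsCactusFrom.empty
  | @edge F _ e x y he hxy hys hy heF ih =>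
    refine IsCactusFrom.edge (ih fun e' he' => hagree e' (Set.mem_insert_of_mem e he'))
      (by rw [hagree e (Set.mem_insert e F), he]) hxy hys
      (fun e' he' => by rw [hagree e' (Set.mem_insert_of_mem e he')]; exact hy e' he') heF
  | @triangle F _ e₁ e₂ e₃ x y z h₁ h₂ h₃ hxy hxz hyz hys hzs hy hz h₁₂ h₁₃ h₂₃ hn₁ hn₂ hn₃ ih =>
    have hmem : ∀ e' ∈ F, e' ∈ insert e₁ (insert e₂ (insert e₃ F)) := fun e' he' =>
      Set.mem_insert_of_mem _ (Set.mem_insert_of_mem _ (Set.mem_insert_of_mem _ he'))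
    refine IsCactusFrom.triangle (ih fun e' he' => hagree e' (hmem e' he'))
      (by rw [hagree e₁ (Set.mem_insert _ _), h₁])
      (by rw [hagree e₂ (Set.mem_insert_of_mem _ (Set.mem_insert _ _)), h₂])
      (by rw [hagree e₃ (Set.mem_insert_of_mem _ (Set.mem_insert_of_mem _ (Set.mem_insert _ _))), h₃])
      hxy hxz hyz hys hzs
      (fun e' he' => by rw [hagree e' (hmem e' he')]; exact hy e' he')
      (fun e' he' => by rw [hagree e' (hmem e' he')]; exact hz e' he')
      h₁₂ h₁₃ h₂₃ hn₁ hn₂ hn₃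

variable {ends : E → Sym2 V}

/-- «`G − T` is a triangular cactus» transfers to the edges of `G/T` not at `t₀`. -/
theorem isCactusFrom_Ft_contract {s : V} {T : Finset V} {t₀ : V} (ht₀ : t₀ ∈ T)
    (hF : IsCactusFrom ends s {e | ∀ t ∈ T, t ∉ ends e}) :
    IsCactusFrom (Contract.contractEnds ends T t₀) s
      (GateFeedback.Ft (Contract.contractEnds ends T t₀) t₀) := by
  rw [GateContract.Ft_contract_eq ht₀]
  exact hF.congr fun e he => by
    rw [Contract.contractEnds_apply]
    exact GateContract.map_contractMap_of_avoid he

variable [Fintype E] [Fintype V]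
variable {R : Type*} [Field R] [LinearOrder R] [IsStrictOrderedRing R]

/-- **THEOREM 2 for an avoided set.** If every cycle of `G` avoiding the set `T` is a triangle
(`G − T` a triangular cactus built from the root), then `(GATE A,{w})` holds at `T` for every entry
set `A`, every root `s ∉ T`, markers `a, b` and exit `w ∉ T`. -/
theorem gateRow_of_isCactus_del_set {p : E → R} (hp : IsProbVec p) (s : V) (T : Finset V)
    (t₀ : V) (a b w : V) (A : Finset V) (ht₀ : t₀ ∈ T) (hs : s ∉ T) (hw : w ∉ T)
    (hF : IsCactusFrom ends s {e | ∀ t ∈ T, t ∉ ends e}) :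
    Gate.GateRow p ends s T a b A {w} := by
  rw [← GateContract.gateRow_contract_rep_iff p ht₀ hs a b A hw]
  exact gateRow_general_of_isCactus_del hp s t₀ a b w A (isCactusFrom_Ft_contract ht₀ hF)
    (fun h => hw (by rw [h]; exact ht₀))

/-- The free one-sided gate at an avoided set `T` with `G − T` a triangular cactus. -/
theorem gateRow_free_of_isCactus_del_set {p : E → R} (hp : IsProbVec p) (s : V) (T : Finset V)
    (t₀ : V) (a b u w : V) (ht₀ : t₀ ∈ T) (hs : s ∉ T) (hw : w ∉ T)
    (hF : IsCactusFrom ends s {e | ∀ t ∈ T, t ∉ ends e}) :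
    Gate.GateRow p ends s T a b {u} {w} :=
  gateRow_of_isCactus_del_set hp s T t₀ a b w {u} ht₀ hs hw hF

/-- **THEOREM 2′ for an avoided set**: `(GATE A,{w})` at `T` whenever `G/T − w` is a triangular
cactus built from the root. -/
theorem gateRow_of_isCactus_del_exit_set {p : E → R} (hp : IsProbVec p) (s : V) (T : Finset V)
    (t₀ : V) (a b w : V) (A : Finset V) (ht₀ : t₀ ∈ T) (hs : s ∉ T) (hw : w ∉ T)
    (hF : IsCactusFrom (Contract.contractEnds ends T t₀) s
      (GateFeedback.Ft (Contract.contractEnds ends T t₀) w)) :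
    Gate.GateRow p ends s T a b A {w} := by
  rw [← GateContract.gateRow_contract_rep_iff p ht₀ hs a b A hw]
  exact gateRow_general_of_isCactus_del_exit hp s t₀ a b w A hF
    (fun h => hw (by rw [h]; exact ht₀))

end CactusGate

end Summit.Ventures.PercRepro2
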